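import Summits.CriticalPhenomena.CardyFormulaZ2.Theorems.CardyIKTransportIKLinearTransportLine
import Literature.Probability.Percolation.TriCrossingsMeet
import Literature.Probability.Percolation.TriHalfAnnulus

/-!
# `CardyIKTransport.IKLinearTransport` (stmt-CriticalPhenomena-5076, line `pinned-diagram-exchange`, lead c8 wave 1) —
# theta-enclosure, part 2: the doubling refinement of the cell triangulation (edges)

Support file (`--supports stmt-CriticalPhenomena-5076`) for the lattice Jordan lemma `thetaEnclosure`.  The cell
triangulation `cellGraph A` of `ℤ²` (nearest neighbours and ONE diagonal per face: the main diagonal of the face with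
lower-left corner `f` when `f ∉ A`, its anti-diagonal when `f ∈ A`) is refined to the square lattice `zdGraph 2` at
double scale, after the template of `Literature/Probability/Percolation/TriCrossingsMeet.lean`: a cell `c` becomes
`2c = triDouble c`, an axis edge the straight two-step walk through the doubled midpoint, the diagonal of the face `f` a
four-step staircase through the doubled face centre `2f + (1, 1)` — through the midpoints of the BOTTOM and TOP sides of
the face for edges of the black class ("mode V", `refineV_*`, class `S = K`) and through the midpoints of the LEFT and
RIGHT sides for the white class ("mode H", `refineH_*`, `S = Kᶜ`).  Every vertex of the mode V refinement of an edge with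
both ends in `S` satisfies an explicit ownership property `OwnV[S, A]` by parity class (doubled cell in `S`; horizontal
midpoint with an end in `S`; vertical midpoint with both ends in `S`; face centre on a diagonal of that face with ends in
`S`), dually `OwnH[S, A]` in mode H, and `OwnV[K, A]`, `OwnH[Kᶜ, A]` are contradictory (`own_disjoint`): refinements
of a black and of a white edge never share a vertex (`theta_refine_edges`, registered) — the planarity input of the
winding argument of part 3 (Kesten 1982, §2.3).  Local notation only, no new definitions.
-/

noncomputable section

namespace Summit.CriticalPhenomena.CardyFormulaZ2.Theorems.IKLinearTransport.PinnedDiagramExchange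

open Literature.Probability.Percolation Literature.Probability.LatticeModels
open SimpleGraph

namespace ThetaEnclosureStub

/-- Ownership of a doubled vertex by the colour class `S` along refinements in mode V (local notation). -/
local notation3 "OwnV[" S ", " A "] " z:max =>
  ((∀ i j : ℤ, (z : Site 2) 0 = 2 * i → (z : Site 2) 1 = 2 * j → (![i, j] : Site 2) ∈ S) ∧
    (∀ i j : ℤ, (z : Site 2) 0 = 2 * i + 1 → (z : Site 2) 1 = 2 * j → (![i, j] : Site 2) ∈ S ∨ (![i + 1, j] : Site 2) ∈ S) ∧
    (∀ i j : ℤ, (z : Site 2) 0 = 2 * i → (z : Site 2) 1 = 2 * j + 1 → (![i, j] : Site 2) ∈ S ∧ (![i, j + 1] : Site 2) ∈ S) ∧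
    (∀ i j : ℤ, (z : Site 2) 0 = 2 * i + 1 → (z : Site 2) 1 = 2 * j + 1 →
      ((![i, j] : Site 2) ∉ A → (![i, j] : Site 2) ∈ S ∧ (![i + 1, j + 1] : Site 2) ∈ S) ∧
      ((![i, j] : Site 2) ∈ A → (![i, j + 1] : Site 2) ∈ S ∧ (![i + 1, j] : Site 2) ∈ S)))

/-- Ownership of a doubled vertex by the colour class `S` along refinements in mode H (local notation). -/
local notation3 "OwnH[" S ", " A "] " z:max =>
  ((∀ i j : ℤ, (z : Site 2) 0 = 2 * i → (z : Site 2) 1 = 2 * j → (![i, j] : Site 2) ∈ S) ∧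
    (∀ i j : ℤ, (z : Site 2) 0 = 2 * i + 1 → (z : Site 2) 1 = 2 * j → (![i, j] : Site 2) ∈ S ∧ (![i + 1, j] : Site 2) ∈ S) ∧
    (∀ i j : ℤ, (z : Site 2) 0 = 2 * i → (z : Site 2) 1 = 2 * j + 1 → (![i, j] : Site 2) ∈ S ∨ (![i, j + 1] : Site 2) ∈ S) ∧
    (∀ i j : ℤ, (z : Site 2) 0 = 2 * i + 1 → (z : Site 2) 1 = 2 * j + 1 →
      ((![i, j] : Site 2) ∉ A → (![i, j] : Site 2) ∈ S ∧ (![i + 1, j + 1] : Site 2) ∈ S) ∧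
      ((![i, j] : Site 2) ∈ A → (![i, j + 1] : Site 2) ∈ S ∧ (![i + 1, j] : Site 2) ∈ S)))

/-- The doubled bounding box of two cells (local notation). -/
local notation3 "Box[" u ", " v "] " z:max =>
  ((min (2 * (u : Site 2) 0) (2 * (v : Site 2) 0) ≤ (z : Site 2) 0 ∧ (z : Site 2) 0 ≤ max (2 * (u : Site 2) 0) (2 * (v : Site 2) 0)) ∧
    (min (2 * (u : Site 2) 1) (2 * (v : Site 2) 1) ≤ (z : Site 2) 1 ∧ (z : Site 2) 1 ≤ max (2 * (u : Site 2) 1) (2 * (v : Site 2) 1)))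

/-! ### Coordinates (`site_eta` is the tree's, `TriHalfAnnulus`) -/

/-- Membership of an explicit point read off from coordinates. [folklore] -/
theorem mem_of_coords {S : Set (Site 2)} {v : Site 2} (hv : v ∈ S) (i j : ℤ) (h0 : v 0 = i) (h1 : v 1 = j) :
    (![i, j] : Site 2) ∈ S := by
  subst h0; subst h1; rwa [site_eta]

/-- The forward relation generating `cellGraph A`, in coordinates. [folklore] -/
theorem fwd_of_rel {A : Set (Site 2)} {u v : Site 2}
    (h : v = u + ![1, 0] ∨ v = u + ![0, 1] ∨ (v = u + ![1, 1] ∧ u ∉ A) ∨ (v = u + ![1, -1] ∧ (u + ![0, -1]) ∈ A)) :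
    (v 0 = u 0 + 1 ∧ v 1 = u 1) ∨ (v 0 = u 0 ∧ v 1 = u 1 + 1) ∨
      (v 0 = u 0 + 1 ∧ v 1 = u 1 + 1 ∧ (![u 0, u 1] : Site 2) ∉ A) ∨
      (v 0 = u 0 + 1 ∧ v 1 = u 1 - 1 ∧ (![u 0, u 1 - 1] : Site 2) ∈ A) := by
  rcases h with rfl | rfl | ⟨rfl, hA⟩ | ⟨rfl, hA⟩
  · exact Or.inl ⟨by simp, by simp⟩
  · exact Or.inr (Or.inl ⟨by simp, by simp⟩)
  · exact Or.inr (Or.inr (Or.inl ⟨by simp, by simp, by rwa [site_eta]⟩))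
  · refine Or.inr (Or.inr (Or.inr ⟨by simp, by simp [sub_eq_add_neg], ?_⟩))
    have e : (u + ![0, -1] : Site 2) = ![u 0, u 1 - 1] := by funext k; fin_cases k <;> simp [sub_eq_add_neg]
    rwa [e] at hA

/-- Adjacency of the cell triangulation in coordinates: one of the four forward steps `e₀`, `e₁`, the main diagonal
of a face off `A`, the anti-diagonal of a face in `A`, in one of the two directions. [folklore] -/
theorem cell_adj_cases {A : Set (Site 2)} {u v : Site 2} (h : (cellGraph A).Adj u v) :
    ((v 0 = u 0 + 1 ∧ v 1 = u 1) ∨ (v 0 = u 0 ∧ v 1 = u 1 + 1) ∨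
      (v 0 = u 0 + 1 ∧ v 1 = u 1 + 1 ∧ (![u 0, u 1] : Site 2) ∉ A) ∨
      (v 0 = u 0 + 1 ∧ v 1 = u 1 - 1 ∧ (![u 0, u 1 - 1] : Site 2) ∈ A)) ∨
    ((u 0 = v 0 + 1 ∧ u 1 = v 1) ∨ (u 0 = v 0 ∧ u 1 = v 1 + 1) ∨
      (u 0 = v 0 + 1 ∧ u 1 = v 1 + 1 ∧ (![v 0, v 1] : Site 2) ∉ A) ∨
      (u 0 = v 0 + 1 ∧ u 1 = v 1 - 1 ∧ (![v 0, v 1 - 1] : Site 2) ∈ A)) := by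
  simp only [cellGraph, SimpleGraph.fromRel_adj] at h
  obtain ⟨_, h | h⟩ := h
  · exact Or.inl (fwd_of_rel h)
  · exact Or.inr (fwd_of_rel h)

/-! ### Ownership at the four parity classes -/

section OwnLemmas

variable {P₁ P₂ P₃ P₄ : ℤ → ℤ → Prop} {z : Site 2}

/-- A parity-class property read off at a doubled cell `(2i, 2j)`. [folklore] -/
theorem own_ee (i j : ℤ) (h0 : z 0 = 2 * i) (h1 : z 1 = 2 * j) (h : P₁ i j) :
    (∀ i j : ℤ, z 0 = 2 * i → z 1 = 2 * j → P₁ i j) ∧ (∀ i j : ℤ, z 0 = 2 * i + 1 → z 1 = 2 * j → P₂ i j) ∧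
      (∀ i j : ℤ, z 0 = 2 * i → z 1 = 2 * j + 1 → P₃ i j) ∧
      (∀ i j : ℤ, z 0 = 2 * i + 1 → z 1 = 2 * j + 1 → P₄ i j) := by
  refine ⟨fun i' j' h0' h1' => ?_, fun i' j' h0' h1' => by omega, fun i' j' h0' h1' => by omega,
    fun i' j' h0' h1' => by omega⟩
  obtain ⟨rfl, rfl⟩ : i' = i ∧ j' = j := ⟨by omega, by omega⟩; exact h

/-- A parity-class property read off at a horizontal midpoint `(2i + 1, 2j)`. [folklore] -/
theorem own_oe (i j : ℤ) (h0 : z 0 = 2 * i + 1) (h1 : z 1 = 2 * j) (h : P₂ i j) :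
    (∀ i j : ℤ, z 0 = 2 * i → z 1 = 2 * j → P₁ i j) ∧ (∀ i j : ℤ, z 0 = 2 * i + 1 → z 1 = 2 * j → P₂ i j) ∧
      (∀ i j : ℤ, z 0 = 2 * i → z 1 = 2 * j + 1 → P₃ i j) ∧
      (∀ i j : ℤ, z 0 = 2 * i + 1 → z 1 = 2 * j + 1 → P₄ i j) := by
  refine ⟨fun i' j' h0' h1' => by omega, fun i' j' h0' h1' => ?_, fun i' j' h0' h1' => by omega,
    fun i' j' h0' h1' => by omega⟩
  obtain ⟨rfl, rfl⟩ : i' = i ∧ j' = j := ⟨by omega, by omega⟩; exact h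

/-- A parity-class property read off at a vertical midpoint `(2i, 2j + 1)`. [folklore] -/
theorem own_eo (i j : ℤ) (h0 : z 0 = 2 * i) (h1 : z 1 = 2 * j + 1) (h : P₃ i j) :
    (∀ i j : ℤ, z 0 = 2 * i → z 1 = 2 * j → P₁ i j) ∧ (∀ i j : ℤ, z 0 = 2 * i + 1 → z 1 = 2 * j → P₂ i j) ∧
      (∀ i j : ℤ, z 0 = 2 * i → z 1 = 2 * j + 1 → P₃ i j) ∧
      (∀ i j : ℤ, z 0 = 2 * i + 1 → z 1 = 2 * j + 1 → P₄ i j) := by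
  refine ⟨fun i' j' h0' h1' => by omega, fun i' j' h0' h1' => by omega, fun i' j' h0' h1' => ?_,
    fun i' j' h0' h1' => by omega⟩
  obtain ⟨rfl, rfl⟩ : i' = i ∧ j' = j := ⟨by omega, by omega⟩; exact h

/-- A parity-class property read off at a face centre `(2i + 1, 2j + 1)`. [folklore] -/
theorem own_oo (i j : ℤ) (h0 : z 0 = 2 * i + 1) (h1 : z 1 = 2 * j + 1) (h : P₄ i j) :
    (∀ i j : ℤ, z 0 = 2 * i → z 1 = 2 * j → P₁ i j) ∧ (∀ i j : ℤ, z 0 = 2 * i + 1 → z 1 = 2 * j → P₂ i j) ∧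
      (∀ i j : ℤ, z 0 = 2 * i → z 1 = 2 * j + 1 → P₃ i j) ∧
      (∀ i j : ℤ, z 0 = 2 * i + 1 → z 1 = 2 * j + 1 → P₄ i j) := by
  refine ⟨fun i' j' h0' h1' => by omega, fun i' j' h0' h1' => by omega, fun i' j' h0' h1' => by omega,
    fun i' j' h0' h1' => ?_⟩
  obtain ⟨rfl, rfl⟩ : i' = i ∧ j' = j := ⟨by omega, by omega⟩; exact h

end OwnLemmas

section Cells

variable {S A : Set (Site 2)} {u v z : Site 2}

/-- A doubled cell of `S` is V-owned by `S`. [folklore] -/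
theorem ownV_double (hu : u ∈ S) : OwnV[S, A] (triDouble u) :=
  own_ee (u 0) (u 1) (by simp) (by simp) (by rwa [site_eta])

/-- A doubled cell of `S` is H-owned by `S`. [folklore] -/
theorem ownH_double (hu : u ∈ S) : OwnH[S, A] (triDouble u) :=
  own_ee (u 0) (u 1) (by simp) (by simp) (by rwa [site_eta])

/-- The first end of a cell edge lies in its doubled bounding box. [folklore] -/
theorem boxL : Box[u, v] (triDouble u) := by simp only [triDouble_apply_zero, triDouble_apply_one]; omega

/-- The second end of a cell edge lies in its doubled bounding box. [folklore] -/
theorem boxR : Box[u, v] (triDouble v) := by simp only [triDouble_apply_zero, triDouble_apply_one]; omega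

/-- Bounding box membership of an explicit point. [folklore] -/
theorem box_vec {x y : ℤ} (h : (min (2 * u 0) (2 * v 0) ≤ x ∧ x ≤ max (2 * u 0) (2 * v 0)) ∧
    (min (2 * u 1) (2 * v 1) ≤ y ∧ y ≤ max (2 * u 1) (2 * v 1))) : Box[u, v] ![x, y] := h

/-- **The two ownerships are contradictory**: no doubled vertex is V-owned by `K` and H-owned by `Kᶜ`
(two cell edges of different colours whose refinements would share a vertex share an endpoint). [folklore] -/
theorem own_disjoint {K : Set (Site 2)} (hV : OwnV[K, A] z) (hH : OwnH[Kᶜ, A] z) : False := by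
  obtain ⟨h1, h2, h3, h4⟩ := hV
  obtain ⟨g1, g2, g3, g4⟩ := hH
  rcases Int.emod_two_eq_zero_or_one (z 0) with e0 | e0 <;>
    rcases Int.emod_two_eq_zero_or_one (z 1) with e1 | e1
  · have a0 : z 0 = 2 * (z 0 / 2) := by omega
    have a1 : z 1 = 2 * (z 1 / 2) := by omega
    exact g1 _ _ a0 a1 (h1 _ _ a0 a1)
  · have a0 : z 0 = 2 * (z 0 / 2) := by omega
    have a1 : z 1 = 2 * (z 1 / 2) + 1 := by omega
    obtain ⟨k1, k2⟩ := h3 _ _ a0 a1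
    exact (g3 _ _ a0 a1).elim (fun g => g k1) (fun g => g k2)
  · have a0 : z 0 = 2 * (z 0 / 2) + 1 := by omega
    have a1 : z 1 = 2 * (z 1 / 2) := by omega
    obtain ⟨k1, k2⟩ := g2 _ _ a0 a1
    exact (h2 _ _ a0 a1).elim (fun k => k1 k) (fun k => k2 k)
  · have a0 : z 0 = 2 * (z 0 / 2) + 1 := by omega
    have a1 : z 1 = 2 * (z 1 / 2) + 1 := by omega
    obtain ⟨k1, k2⟩ := h4 _ _ a0 a1
    obtain ⟨l1, l2⟩ := g4 _ _ a0 a1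
    by_cases hA : (![z 0 / 2, z 1 / 2] : Site 2) ∈ A
    · exact (l2 hA).1 (k2 hA).1
    · exact (l1 hA).1 (k1 hA).1

end Cells

/-! ### Refinement of one cell edge -/

/-- A two-step walk `x → m → y` all of whose vertices satisfy `P`. [folklore] -/
theorem walk_two (P : Site 2 → Prop) {x y : Site 2} (m : Site 2) (h₁ : (zdGraph 2).Adj x m)
    (h₂ : (zdGraph 2).Adj m y) (hx : P x) (hm : P m) (hy : P y) :
    ∃ W : (zdGraph 2).Walk x y, ∀ z ∈ W.support, P z := by
  refine ⟨Walk.cons h₁ (Walk.cons h₂ Walk.nil), fun z hz => ?_⟩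
  simp only [Walk.support_cons, Walk.support_nil, List.mem_cons, List.not_mem_nil, or_false] at hz
  rcases hz with rfl | rfl | rfl <;> assumption

/-- A four-step walk `x → m₁ → m₂ → m₃ → y` all of whose vertices satisfy `P`. [folklore] -/
theorem walk_four (P : Site 2 → Prop) {x y : Site 2} (m₁ m₂ m₃ : Site 2) (h₁ : (zdGraph 2).Adj x m₁)
    (h₂ : (zdGraph 2).Adj m₁ m₂) (h₃ : (zdGraph 2).Adj m₂ m₃) (h₄ : (zdGraph 2).Adj m₃ y)
    (hx : P x) (hm₁ : P m₁) (hm₂ : P m₂) (hm₃ : P m₃) (hy : P y) :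
    ∃ W : (zdGraph 2).Walk x y, ∀ z ∈ W.support, P z := by
  refine ⟨Walk.cons h₁ (Walk.cons h₂ (Walk.cons h₃ (Walk.cons h₄ Walk.nil))), fun z hz => ?_⟩
  simp only [Walk.support_cons, Walk.support_nil, List.mem_cons, List.not_mem_nil, or_false] at hz
  rcases hz with rfl | rfl | rfl | rfl | rfl <;> assumption

section Edges

variable {S A : Set (Site 2)} {u v : Site 2}

/-- Mode V refinement of the horizontal cell edge `u → u + e₀` (through the doubled midpoint). [folklore] -/
theorem refineV_right (h0 : v 0 = u 0 + 1) (h1 : v 1 = u 1) (hu : u ∈ S) (hv : v ∈ S) :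
    ∃ W : (zdGraph 2).Walk (triDouble u) (triDouble v), ∀ z ∈ W.support, OwnV[S, A] z ∧ Box[u, v] z :=
  walk_two (fun z => OwnV[S, A] z ∧ Box[u, v] z) ![2 * u 0 + 1, 2 * u 1]
    (zdGraph_two_adj_of_coord (Or.inl ⟨by simp, by simp⟩))
    (zdGraph_two_adj_of_coord (Or.inl ⟨by simp [h0]; ring, by simp [h1]⟩))
    ⟨ownV_double hu, boxL⟩
    ⟨own_oe (u 0) (u 1) rfl rfl (Or.inl (mem_of_coords hu _ _ rfl rfl)), box_vec (by omega)⟩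
    ⟨ownV_double hv, boxR⟩

/-- Mode V refinement of the vertical cell edge `u → u + e₁` (through the doubled midpoint). [folklore] -/
theorem refineV_up (h0 : v 0 = u 0) (h1 : v 1 = u 1 + 1) (hu : u ∈ S) (hv : v ∈ S) :
    ∃ W : (zdGraph 2).Walk (triDouble u) (triDouble v), ∀ z ∈ W.support, OwnV[S, A] z ∧ Box[u, v] z :=
  walk_two (fun z => OwnV[S, A] z ∧ Box[u, v] z) ![2 * u 0, 2 * u 1 + 1]
    (zdGraph_two_adj_of_coord (Or.inr (Or.inr (Or.inl ⟨by simp, by simp⟩))))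
    (zdGraph_two_adj_of_coord (Or.inr (Or.inr (Or.inl ⟨by simp [h1]; ring, by simp [h0]⟩))))
    ⟨ownV_double hu, boxL⟩
    ⟨own_eo (u 0) (u 1) rfl rfl ⟨mem_of_coords hu _ _ rfl rfl, mem_of_coords hv _ _ h0 h1⟩, box_vec (by omega)⟩
    ⟨ownV_double hv, boxR⟩

/-- Mode V refinement of the main diagonal `u → u + (1, 1)` of the face `u ∉ A`: the staircase through the midpoint
of the bottom side, the centre and the midpoint of the top side of the face. [folklore] -/
theorem refineV_diag (h0 : v 0 = u 0 + 1) (h1 : v 1 = u 1 + 1) (hA : (![u 0, u 1] : Site 2) ∉ A)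
    (hu : u ∈ S) (hv : v ∈ S) :
    ∃ W : (zdGraph 2).Walk (triDouble u) (triDouble v), ∀ z ∈ W.support, OwnV[S, A] z ∧ Box[u, v] z :=
  walk_four (fun z => OwnV[S, A] z ∧ Box[u, v] z)
    ![2 * u 0 + 1, 2 * u 1] ![2 * u 0 + 1, 2 * u 1 + 1] ![2 * u 0 + 1, 2 * u 1 + 2]
    (zdGraph_two_adj_of_coord (Or.inl ⟨by simp, by simp⟩))
    (zdGraph_two_adj_of_coord (Or.inr (Or.inr (Or.inl ⟨by simp, by simp⟩))))
    (zdGraph_two_adj_of_coord (Or.inr (Or.inr (Or.inl ⟨by simp; ring, by simp⟩))))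
    (zdGraph_two_adj_of_coord (Or.inl ⟨by simp [h0]; ring, by simp [h1]; ring⟩))
    ⟨ownV_double hu, boxL⟩
    ⟨own_oe (u 0) (u 1) rfl rfl (Or.inl (mem_of_coords hu _ _ rfl rfl)), box_vec (by omega)⟩
    ⟨own_oo (u 0) (u 1) rfl rfl
      ⟨fun _ => ⟨mem_of_coords hu _ _ rfl rfl, mem_of_coords hv _ _ h0 h1⟩, fun h => absurd h hA⟩, box_vec (by omega)⟩
    ⟨own_oe (u 0) (u 1 + 1) rfl (by simp; ring) (Or.inr (mem_of_coords hv _ _ h0 h1)), box_vec (by omega)⟩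
    ⟨ownV_double hv, boxR⟩

/-- Mode V refinement of the anti-diagonal `u → u + (1, -1)` of the face `u - e₁ ∈ A`: the staircase through the
midpoint of the top side, the centre and the midpoint of the bottom side of the face. [folklore] -/
theorem refineV_anti (h0 : v 0 = u 0 + 1) (h1 : v 1 = u 1 - 1) (hA : (![u 0, u 1 - 1] : Site 2) ∈ A)
    (hu : u ∈ S) (hv : v ∈ S) :
    ∃ W : (zdGraph 2).Walk (triDouble u) (triDouble v), ∀ z ∈ W.support, OwnV[S, A] z ∧ Box[u, v] z :=
  walk_four (fun z => OwnV[S, A] z ∧ Box[u, v] z)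
    ![2 * u 0 + 1, 2 * u 1] ![2 * u 0 + 1, 2 * u 1 - 1] ![2 * u 0 + 1, 2 * u 1 - 2]
    (zdGraph_two_adj_of_coord (Or.inl ⟨by simp, by simp⟩))
    (zdGraph_two_adj_of_coord (Or.inr (Or.inr (Or.inr ⟨by simp, by simp⟩))))
    (zdGraph_two_adj_of_coord (Or.inr (Or.inr (Or.inr ⟨by simp; ring, by simp⟩))))
    (zdGraph_two_adj_of_coord (Or.inl ⟨by simp [h0]; ring, by simp [h1]; ring⟩))
    ⟨ownV_double hu, boxL⟩
    ⟨own_oe (u 0) (u 1) rfl rfl (Or.inl (mem_of_coords hu _ _ rfl rfl)), box_vec (by omega)⟩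
    ⟨own_oo (u 0) (u 1 - 1) rfl (by simp; ring)
      ⟨fun h => absurd hA h, fun _ => ⟨mem_of_coords hu _ _ rfl (by ring), mem_of_coords hv _ _ h0 h1⟩⟩,
      box_vec (by omega)⟩
    ⟨own_oe (u 0) (u 1 - 1) rfl (by simp; ring) (Or.inr (mem_of_coords hv _ _ h0 h1)), box_vec (by omega)⟩
    ⟨ownV_double hv, boxR⟩

/-- Mode H refinement of the horizontal cell edge `u → u + e₀` (through the doubled midpoint). [folklore] -/
theorem refineH_right (h0 : v 0 = u 0 + 1) (h1 : v 1 = u 1) (hu : u ∈ S) (hv : v ∈ S) :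
    ∃ W : (zdGraph 2).Walk (triDouble u) (triDouble v), ∀ z ∈ W.support, OwnH[S, A] z ∧ Box[u, v] z :=
  walk_two (fun z => OwnH[S, A] z ∧ Box[u, v] z) ![2 * u 0 + 1, 2 * u 1]
    (zdGraph_two_adj_of_coord (Or.inl ⟨by simp, by simp⟩))
    (zdGraph_two_adj_of_coord (Or.inl ⟨by simp [h0]; ring, by simp [h1]⟩))
    ⟨ownH_double hu, boxL⟩
    ⟨own_oe (u 0) (u 1) rfl rfl ⟨mem_of_coords hu _ _ rfl rfl, mem_of_coords hv _ _ h0 h1⟩, box_vec (by omega)⟩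
    ⟨ownH_double hv, boxR⟩

/-- Mode H refinement of the vertical cell edge `u → u + e₁` (through the doubled midpoint). [folklore] -/
theorem refineH_up (h0 : v 0 = u 0) (h1 : v 1 = u 1 + 1) (hu : u ∈ S) (hv : v ∈ S) :
    ∃ W : (zdGraph 2).Walk (triDouble u) (triDouble v), ∀ z ∈ W.support, OwnH[S, A] z ∧ Box[u, v] z :=
  walk_two (fun z => OwnH[S, A] z ∧ Box[u, v] z) ![2 * u 0, 2 * u 1 + 1]
    (zdGraph_two_adj_of_coord (Or.inr (Or.inr (Or.inl ⟨by simp, by simp⟩))))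
    (zdGraph_two_adj_of_coord (Or.inr (Or.inr (Or.inl ⟨by simp [h1]; ring, by simp [h0]⟩))))
    ⟨ownH_double hu, boxL⟩
    ⟨own_eo (u 0) (u 1) rfl rfl (Or.inl (mem_of_coords hu _ _ rfl rfl)), box_vec (by omega)⟩
    ⟨ownH_double hv, boxR⟩

/-- Mode H refinement of the main diagonal `u → u + (1, 1)` of the face `u ∉ A`: the staircase through the midpoint
of the left side, the centre and the midpoint of the right side of the face. [folklore] -/
theorem refineH_diag (h0 : v 0 = u 0 + 1) (h1 : v 1 = u 1 + 1) (hA : (![u 0, u 1] : Site 2) ∉ A)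
    (hu : u ∈ S) (hv : v ∈ S) :
    ∃ W : (zdGraph 2).Walk (triDouble u) (triDouble v), ∀ z ∈ W.support, OwnH[S, A] z ∧ Box[u, v] z :=
  walk_four (fun z => OwnH[S, A] z ∧ Box[u, v] z)
    ![2 * u 0, 2 * u 1 + 1] ![2 * u 0 + 1, 2 * u 1 + 1] ![2 * u 0 + 2, 2 * u 1 + 1]
    (zdGraph_two_adj_of_coord (Or.inr (Or.inr (Or.inl ⟨by simp, by simp⟩))))
    (zdGraph_two_adj_of_coord (Or.inl ⟨by simp, by simp⟩))
    (zdGraph_two_adj_of_coord (Or.inl ⟨by simp; ring, by simp⟩))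
    (zdGraph_two_adj_of_coord (Or.inr (Or.inr (Or.inl ⟨by simp [h1]; ring, by simp [h0]; ring⟩))))
    ⟨ownH_double hu, boxL⟩
    ⟨own_eo (u 0) (u 1) rfl rfl (Or.inl (mem_of_coords hu _ _ rfl rfl)), box_vec (by omega)⟩
    ⟨own_oo (u 0) (u 1) rfl rfl
      ⟨fun _ => ⟨mem_of_coords hu _ _ rfl rfl, mem_of_coords hv _ _ h0 h1⟩, fun h => absurd h hA⟩, box_vec (by omega)⟩
    ⟨own_eo (u 0 + 1) (u 1) (by simp; ring) rfl (Or.inr (mem_of_coords hv _ _ h0 h1)), box_vec (by omega)⟩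
    ⟨ownH_double hv, boxR⟩

/-- Mode H refinement of the anti-diagonal `u → u + (1, -1)` of the face `u - e₁ ∈ A`: the staircase through the
midpoint of the left side, the centre and the midpoint of the right side of the face. [folklore] -/
theorem refineH_anti (h0 : v 0 = u 0 + 1) (h1 : v 1 = u 1 - 1) (hA : (![u 0, u 1 - 1] : Site 2) ∈ A)
    (hu : u ∈ S) (hv : v ∈ S) :
    ∃ W : (zdGraph 2).Walk (triDouble u) (triDouble v), ∀ z ∈ W.support, OwnH[S, A] z ∧ Box[u, v] z :=
  walk_four (fun z => OwnH[S, A] z ∧ Box[u, v] z)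
    ![2 * u 0, 2 * u 1 - 1] ![2 * u 0 + 1, 2 * u 1 - 1] ![2 * u 0 + 2, 2 * u 1 - 1]
    (zdGraph_two_adj_of_coord (Or.inr (Or.inr (Or.inr ⟨by simp, by simp⟩))))
    (zdGraph_two_adj_of_coord (Or.inl ⟨by simp, by simp⟩))
    (zdGraph_two_adj_of_coord (Or.inl ⟨by simp; ring, by simp⟩))
    (zdGraph_two_adj_of_coord (Or.inr (Or.inr (Or.inr ⟨by simp [h1]; ring, by simp [h0]; ring⟩))))
    ⟨ownH_double hu, boxL⟩
    ⟨own_eo (u 0) (u 1 - 1) rfl (by simp; ring) (Or.inr (mem_of_coords hu _ _ rfl (by ring))), box_vec (by omega)⟩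
    ⟨own_oo (u 0) (u 1 - 1) rfl (by simp; ring)
      ⟨fun h => absurd hA h, fun _ => ⟨mem_of_coords hu _ _ rfl (by ring), mem_of_coords hv _ _ h0 h1⟩⟩,
      box_vec (by omega)⟩
    ⟨own_eo (u 0 + 1) (u 1 - 1) (by simp; ring) (by simp; ring) (Or.inl (mem_of_coords hv _ _ h0 h1)),
      box_vec (by omega)⟩
    ⟨ownH_double hv, boxR⟩

/-- Reversal of a mode V edge refinement. [folklore] -/
theorem refineV_rev (h : ∃ W : (zdGraph 2).Walk (triDouble v) (triDouble u), ∀ z ∈ W.support,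
      OwnV[S, A] z ∧ Box[v, u] z) :
    ∃ W : (zdGraph 2).Walk (triDouble u) (triDouble v), ∀ z ∈ W.support, OwnV[S, A] z ∧ Box[u, v] z := by
  obtain ⟨W, hW⟩ := h
  refine ⟨W.reverse, fun z hz => ?_⟩
  rw [Walk.support_reverse, List.mem_reverse] at hz
  exact ⟨(hW z hz).1, by have := (hW z hz).2; omega⟩

/-- Reversal of a mode H edge refinement. [folklore] -/
theorem refineH_rev (h : ∃ W : (zdGraph 2).Walk (triDouble v) (triDouble u), ∀ z ∈ W.support,
      OwnH[S, A] z ∧ Box[v, u] z) :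
    ∃ W : (zdGraph 2).Walk (triDouble u) (triDouble v), ∀ z ∈ W.support, OwnH[S, A] z ∧ Box[u, v] z := by
  obtain ⟨W, hW⟩ := h
  refine ⟨W.reverse, fun z hz => ?_⟩
  rw [Walk.support_reverse, List.mem_reverse] at hz
  exact ⟨(hW z hz).1, by have := (hW z hz).2; omega⟩

/-- **Mode V refinement of a cell edge with ends in `S`**: a `ℤ²`-walk from `2u` to `2v` inside the doubled
bounding box all of whose vertices are V-owned by `S`. [folklore] -/
theorem refineV_adj (h : (cellGraph A).Adj u v) (hu : u ∈ S) (hv : v ∈ S) :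
    ∃ W : (zdGraph 2).Walk (triDouble u) (triDouble v), ∀ z ∈ W.support, OwnV[S, A] z ∧ Box[u, v] z := by
  rcases cell_adj_cases h with (⟨h0, h1⟩ | ⟨h0, h1⟩ | ⟨h0, h1, hA⟩ | ⟨h0, h1, hA⟩) |
      (⟨h0, h1⟩ | ⟨h0, h1⟩ | ⟨h0, h1, hA⟩ | ⟨h0, h1, hA⟩)
  · exact refineV_right h0 h1 hu hv
  · exact refineV_up h0 h1 hu hv
  · exact refineV_diag h0 h1 hA hu hv
  · exact refineV_anti h0 h1 hA hu hv
  · exact refineV_rev (refineV_right h0 h1 hv hu)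
  · exact refineV_rev (refineV_up h0 h1 hv hu)
  · exact refineV_rev (refineV_diag h0 h1 hA hv hu)
  · exact refineV_rev (refineV_anti h0 h1 hA hv hu)

/-- **Mode H refinement of a cell edge with ends in `S`**: a `ℤ²`-walk from `2u` to `2v` inside the doubled
bounding box all of whose vertices are H-owned by `S`. [folklore] -/
theorem refineH_adj (h : (cellGraph A).Adj u v) (hu : u ∈ S) (hv : v ∈ S) :
    ∃ W : (zdGraph 2).Walk (triDouble u) (triDouble v), ∀ z ∈ W.support, OwnH[S, A] z ∧ Box[u, v] z := by
  rcases cell_adj_cases h with (⟨h0, h1⟩ | ⟨h0, h1⟩ | ⟨h0, h1, hA⟩ | ⟨h0, h1, hA⟩) |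
      (⟨h0, h1⟩ | ⟨h0, h1⟩ | ⟨h0, h1, hA⟩ | ⟨h0, h1, hA⟩)
  · exact refineH_right h0 h1 hu hv
  · exact refineH_up h0 h1 hu hv
  · exact refineH_diag h0 h1 hA hu hv
  · exact refineH_anti h0 h1 hA hu hv
  · exact refineH_rev (refineH_right h0 h1 hv hu)
  · exact refineH_rev (refineH_up h0 h1 hv hu)
  · exact refineH_rev (refineH_diag h0 h1 hA hv hu)
  · exact refineH_rev (refineH_anti h0 h1 hA hv hu)

end Edges

end ThetaEnclosureStub

/-- **Refinements of a black and of a white cell edge are vertex-disjoint** (registered support lemma of the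
theta-enclosure, arrow form).  A black edge `u ∼ v` (both cells in `K`) and a white edge `u' ∼ v'` (both cells off
`K`) of the cell triangulation `cellGraph A` have refinements — `ℤ²`-walks between the doubled end cells inside the
doubled bounding boxes of the edges (mode V for the black edge, mode H for the white one) — with no common vertex:
edges of different colours of a triangulation do not cross (Kesten 1982, §2.3, through the doubling refinement of
`TriCrossingsMeet`). [folklore] -/
theorem theta_refine_edges : ∀ (A K : Set (Site 2)) (u v u' v' : Site 2), (cellGraph A).Adj u v → u ∈ K → v ∈ K → (cellGraph A).Adj u' v' → u' ∉ K → v' ∉ K → ∃ W : (zdGraph 2).Walk (triDouble u) (triDouble v), ∃ W' : (zdGraph 2).Walk (triDouble u') (triDouble v'), (∀ z ∈ W.support, (min (2 * u 0) (2 * v 0) ≤ z 0 ∧ z 0 ≤ max (2 * u 0) (2 * v 0)) ∧ (min (2 * u 1) (2 * v 1) ≤ z 1 ∧ z 1 ≤ max (2 * u 1) (2 * v 1))) ∧ (∀ z ∈ W'.support, (min (2 * u' 0) (2 * v' 0) ≤ z 0 ∧ z 0 ≤ max (2 * u' 0) (2 * v' 0)) ∧ (min (2 * u' 1) (2 * v'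 1) ≤ z 1 ∧ z 1 ≤ max (2 * u' 1) (2 * v' 1))) ∧ ∀ z ∈ W'.support, z ∉ W.support := by
  intro A K u v u' v' huv hu hv hu'v' hu' hv'
  obtain ⟨W, hW⟩ := ThetaEnclosureStub.refineV_adj (S := K) huv hu hv
  obtain ⟨W', hW'⟩ := ThetaEnclosureStub.refineH_adj (S := Kᶜ) hu'v' hu' hv'
  exact ⟨W, W', fun z hz => (hW z hz).2, fun z hz => (hW' z hz).2,
    fun z hz' hz => ThetaEnclosureStub.own_disjoint (hW z hz).1 (hW' z hz').1⟩

end Summit.CriticalPhenomena.CardyFormulaZ2.Theorems.IKLinearTransport.PinnedDiagramExchange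

end
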